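import Mathlib
import Summits.KontsevichZagierPeriods.Zeta5Search.BrickResidueLawTwoZero
import Summits.KontsevichZagierPeriods.Zeta5Search.BrickHatTwoCells

/-!
# BrickHoleResidueLawTwo — the residue law at the prime `2` for the HOLES of the centre-free brick kernel: an odd pole `2K+1` of
an even row `2N+2` against the pole `K` of the row `N`, cells AND harmonic cell, with the multiplier `μ = 2^A·h_0`
(the `p = 2` counterpart of `BrickLevelReductionInf.hole_cell_le` / `hole_cellZero_le`; cell `pub-zeta5`, seat ct-1 g42)

HONEST FRAMING: systematic search; no irrationality claim unless certified.  INSTRUMENT valuations of Laurent / harmonic cells of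
the centre-free brick kernel (`BrickLaurent`, `BrickPartialFractions`); nothing about `ζ(5)`/`ζ(3)`; no `γ`/record statement;
records in print UNMOVED; NOTHING IS DISCHARGED (net named-fact debt 0).

* **`residueLaw_two_hat`** — for `K ≤ N < 2^{L+1}`, `2B ≤ A`, `1 ≤ A`, every `d`:
  `v₂(2^{(L+1)d}·laurent(2N+2, 2K+1, d) − 2^A h_0·(2^{Ld}·laurent(N, K, d))) ≤ exp(−(L+1))` (in fact `≤ exp(−(L+A))`:
  `residueLaw_two_hat_sharp`), from `BrickHatTwoCells.laurent_two_hat` (`h ∈ ℤ_(2)⟦T⟧`, prefactor `2^A`);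
* `cTop_two_hat` — `c̃_{2K+1,A}(2N+2) = 2^A·h_0·c̃_{K,A}(N)` (so `μ = 2^A h_0` is the chain's hole multiplier `μ_k`);
* **`residueLawZero_two_hat`** — the harmonic cell, by `BrickResidueLawTwoZero.residueLawZero_of_depth` (`⌊(2K+1)/2⌋ = K`).

With `BrickResidueLawTwo{,Zero}` every summand of a one-level reduction at `2` (° cells of both row parities, holes) now has its
residue law; the ASSEMBLY (digit split at `2`) and the block-weight step remain.  Theorems only (0 `def`); nothing restated.
-/

namespace Summit.KontsevichZagierPeriods.Zeta5Search.BrickHoleResidueLawTwo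

open Finset Nat Polynomial WithZero
open Summit.KontsevichZagierPeriods.Zeta5Search.BrickTopCoefficient (cTop)
open Summit.KontsevichZagierPeriods.Zeta5Search.BrickLaurent (expandAt laurent laurent_zero)
open Summit.KontsevichZagierPeriods.Zeta5Search.BrickPartialFractions (cellZero)
open Summit.KontsevichZagierPeriods.Zeta5Search.ScaledSeries (IsSlopeInt)
open Summit.KontsevichZagierPeriods.Zeta5Search.BrickHatTwoCells (laurent_two_hat isSlopeInt_hatSeries)
open Summit.KontsevichZagierPeriods.Zeta5Search.BrickResidueLawTwo (remainder_le padicValuation_two_pow)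
open Summit.KontsevichZagierPeriods.Zeta5Search.BrickResidueLawTwoZero (residueLawZero_of_depth)

noncomputable section

section hat

variable {A B : ℕ} (hAB : 2 * B ≤ A) {L N K : ℕ} (hN : N < 2 ^ (L + 1)) (hK : K ≤ N)
include hAB hK

/-- The top coefficients across the hat: `c̃_{2K+1,A}(2N+2) = 2^A·h_0·c̃_{K,A}(N)`. -/
theorem cTop_two_hat :
    cTop A B 0 (2 * N + 2) (2 * K + 1) = (2 : ℚ) ^ A *
      PowerSeries.coeff 0 (expandAt 0 (C ((((N : ℚ) + 1) * ∏ i ∈ range (N + 1), (2 * (i : ℚ) + 1)) ^ (A - 2 * B)) *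
            ((∏ i ∈ Icc 1 (N + 1), (C (-(2 * (K : ℚ)) - 2 * i - 1) + C (2 : ℚ) * X)) *
              ∏ i ∈ Icc 1 (N + 1), (C (-(2 * (K : ℚ)) + 2 * N + 2 * i + 1) + C (2 : ℚ) * X)) ^ B *
            ((X - C ((K : ℚ) + N + 1)) * (X + C (((2 * N + 1 : ℕ) : ℚ) - K))) ^ B)
          ((∏ i ∈ range (N + 1 + 1), (C (2 * (i : ℚ) - 1 - 2 * K) + C (2 : ℚ) * X)) ^ A)) * cTop A B 0 N K := by
  have h := laurent_two_hat hAB hK 0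
  rw [pow_zero, one_mul, Finset.Nat.antidiagonal_zero, Finset.sum_singleton] at h
  dsimp only at h
  rw [laurent_zero hAB 0 (by omega : 2 * K + 1 ≤ 2 * N + 2), laurent_zero hAB 0 hK] at h
  rw [h]; ring

include hN

/-- **Hole residue law at `2`, sharp form**: `v₂(2^{(L+1)d}·laurent(2N+2, 2K+1, d) − 2^A h_0·(2^{Ld}·laurent(N, K, d))) ≤ exp(−(L+A))`
(the remainder terms `h_m·laurent(N,K,d−m)`, `m ≥ 1`, carry `2^A` and `2^{Lm}`). -/
theorem residueLaw_two_hat_sharp (d : ℕ) :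
    Rat.padicValuation 2 ((2 : ℚ) ^ ((L + 1) * d) * laurent A B 0 (2 * N + 2) (2 * K + 1) d -
      (2 : ℚ) ^ A * PowerSeries.coeff 0 (expandAt 0
          (C ((((N : ℚ) + 1) * ∏ i ∈ range (N + 1), (2 * (i : ℚ) + 1)) ^ (A - 2 * B)) *
            ((∏ i ∈ Icc 1 (N + 1), (C (-(2 * (K : ℚ)) - 2 * i - 1) + C (2 : ℚ) * X)) *
              ∏ i ∈ Icc 1 (N + 1), (C (-(2 * (K : ℚ)) + 2 * N + 2 * i + 1) + C (2 : ℚ) * X)) ^ B *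
            ((X - C ((K : ℚ) + N + 1)) * (X + C (((2 * N + 1 : ℕ) : ℚ) - K))) ^ B)
          ((∏ i ∈ range (N + 1 + 1), (C (2 * (i : ℚ) - 1 - 2 * K) + C (2 : ℚ) * X)) ^ A)) *
        ((2 : ℚ) ^ (L * d) * laurent A B 0 N K d)) ≤ exp (-((L : ℤ) + A)) := by
  set W := expandAt 0
          (C ((((N : ℚ) + 1) * ∏ i ∈ range (N + 1), (2 * (i : ℚ) + 1)) ^ (A - 2 * B)) *
            ((∏ i ∈ Icc 1 (N + 1), (C (-(2 * (K : ℚ)) - 2 * i - 1) + C (2 : ℚ) * X)) *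
              ∏ i ∈ Icc 1 (N + 1), (C (-(2 * (K : ℚ)) + 2 * N + 2 * i + 1) + C (2 : ℚ) * X)) ^ B *
            ((X - C ((K : ℚ) + N + 1)) * (X + C (((2 * N + 1 : ℕ) : ℚ) - K))) ^ B)
          ((∏ i ∈ range (N + 1 + 1), (C (2 * (i : ℚ) - 1 - 2 * K) + C (2 : ℚ) * X)) ^ A) with hW
  have hWint : IsSlopeInt 2 0 0 W := isSlopeInt_hatSeries A B N K
  rcases d with _ | d
  · rw [mul_zero, mul_zero, pow_zero, one_mul, one_mul, laurent_zero hAB 0 (by omega : 2 * K + 1 ≤ 2 * N + 2),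
      laurent_zero hAB 0 hK, cTop_two_hat hAB hK, sub_self, map_zero]
    exact zero_le
  have h := laurent_two_hat hAB hK (d + 1)
  rw [← hW, Finset.Nat.sum_antidiagonal_succ] at h
  dsimp only at h
  have key : (2 : ℚ) ^ ((L + 1) * (d + 1)) * laurent A B 0 (2 * N + 2) (2 * K + 1) (d + 1) -
      (2 : ℚ) ^ A * PowerSeries.coeff 0 W * ((2 : ℚ) ^ (L * (d + 1)) * laurent A B 0 N K (d + 1)) =
      (2 : ℚ) ^ A * ((2 : ℚ) ^ (L * (d + 1)) *
        ∑ x ∈ antidiagonal d, PowerSeries.coeff (x.1 + 1) W * laurent A B 0 N K x.2) := by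
    have e : (2 : ℚ) ^ ((L + 1) * (d + 1)) = (2 : ℚ) ^ (L * (d + 1)) * (2 : ℚ) ^ (d + 1) := by
      rw [← pow_add]; congr 1; ring
    rw [e, mul_assoc, h]
    ring
  rw [key, map_mul, padicValuation_two_pow]
  have hrem := remainder_le hAB hN hK d (c := 0) (u := fun m => PowerSeries.coeff m W) fun m => by
    have h1 := hWint (m + 1)
    rw [zero_mul, zero_add, exp_zero] at h1
    rwa [neg_zero, exp_zero]
  rw [add_zero] at hrem
  calc _ ≤ exp (-(A : ℤ)) * exp (-(L : ℤ)) := mul_le_mul' le_rfl hrem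
    _ = _ := by rw [← exp_add]; congr 1; ring

/-- **Hole residue law at `2`** (`1 ≤ A`): the same with the bound `exp(−(L+1))` that a one-level reduction consumes. -/
theorem residueLaw_two_hat (hA : 1 ≤ A) (d : ℕ) :
    Rat.padicValuation 2 ((2 : ℚ) ^ ((L + 1) * d) * laurent A B 0 (2 * N + 2) (2 * K + 1) d -
      (2 : ℚ) ^ A * PowerSeries.coeff 0 (expandAt 0
          (C ((((N : ℚ) + 1) * ∏ i ∈ range (N + 1), (2 * (i : ℚ) + 1)) ^ (A - 2 * B)) *
            ((∏ i ∈ Icc 1 (N + 1), (C (-(2 * (K : ℚ)) - 2 * i - 1) + C (2 : ℚ) * X)) *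
              ∏ i ∈ Icc 1 (N + 1), (C (-(2 * (K : ℚ)) + 2 * N + 2 * i + 1) + C (2 : ℚ) * X)) ^ B *
            ((X - C ((K : ℚ) + N + 1)) * (X + C (((2 * N + 1 : ℕ) : ℚ) - K))) ^ B)
          ((∏ i ∈ range (N + 1 + 1), (C (2 * (i : ℚ) - 1 - 2 * K) + C (2 : ℚ) * X)) ^ A)) *
        ((2 : ℚ) ^ (L * d) * laurent A B 0 N K d)) ≤ exp (-((L : ℤ) + 1)) :=
  (residueLaw_two_hat_sharp hAB hN hK d).trans (exp_le_exp.2 (by omega))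

/-- **Hole residue law at `2`, harmonic cell** (`1 ≤ A`):
`v₂(2^{(L+1)A}·c̃⁰_{2K+1}(2N+2) − 2^A h_0·(2^{LA}·c̃⁰_K(N))) ≤ exp(−(L+1))`. -/
theorem residueLawZero_two_hat (hA : 1 ≤ A) :
    Rat.padicValuation 2 ((2 : ℚ) ^ ((L + 1) * A) * cellZero A B 0 (2 * N + 2) (2 * K + 1) -
      (2 : ℚ) ^ A * PowerSeries.coeff 0 (expandAt 0
          (C ((((N : ℚ) + 1) * ∏ i ∈ range (N + 1), (2 * (i : ℚ) + 1)) ^ (A - 2 * B)) *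
            ((∏ i ∈ Icc 1 (N + 1), (C (-(2 * (K : ℚ)) - 2 * i - 1) + C (2 : ℚ) * X)) *
              ∏ i ∈ Icc 1 (N + 1), (C (-(2 * (K : ℚ)) + 2 * N + 2 * i + 1) + C (2 : ℚ) * X)) ^ B *
            ((X - C ((K : ℚ) + N + 1)) * (X + C (((2 * N + 1 : ℕ) : ℚ) - K))) ^ B)
          ((∏ i ∈ range (N + 1 + 1), (C (2 * (i : ℚ) - 1 - 2 * K) + C (2 : ℚ) * X)) ^ A)) *
        ((2 : ℚ) ^ (L * A) * cellZero A B 0 N K)) ≤ exp (-((L : ℤ) + 1)) := by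
  refine residueLawZero_of_depth hAB hN hK (by omega) ?_ (residueLaw_two_hat hAB hN hK hA)
  have h0 := isSlopeInt_hatSeries A B N K 0
  rw [zero_mul, zero_add, exp_zero] at h0
  rw [map_mul, padicValuation_two_pow]
  exact mul_le_one' (by rw [← exp_zero, exp_le_exp]; omega) h0

end hat

end

end Summit.KontsevichZagierPeriods.Zeta5Search.BrickHoleResidueLawTwo
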